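import Literature.NumberTheory.Automorphic.Liu2021.AppendixC.EtaleH1Tower
import Literature.NumberTheory.Automorphic.Liu2021.AppendixC.Prop413DataOfTower
import Literature.AlgebraicGeometry.ComplexMultiplication.TateModuleOfCMFreeRankOne
import HarnessLib

/-!
# [Liu 2021, Thm 4.15] PINNED at the `ℓ`-adic cohomology of the Albanese tower: the Galois group acts on
# `Hom_{ℚ_ℓ^{ac}[𝔾(𝔸_F^∞)]}(ι_ℓ ∘ ω(μ,ε,χ), H¹_ét(A_∞, ℚ_ℓ^{ac}))` through the character of the `M_μ`-eigenline of `H¹_ét(A_μ)`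

Topic `NumberTheory/Automorphic/Liu2021/AppendixC`; namespace `Literature.NumberTheory.Automorphic.Liu2021.AppendixC`.
Interface row III-9′ («`Thm415Pinned`») of the cell `hodgecm-mathlib` (director GO 2026-08-28T00:59:49Z; carrier decisions A-plan2
01:07:33Z (1)–(3)); consumer = the v2 split `S_T` of `stub_mainGalois` of `Lines/a3-liu418.lean` (binder `hLiu418` =
[Liu 2021, Thm 4.18]).  THREE definitions with bodies (`EtaleHeckeDatum.omegaHom`, `cmEigenline`, the bookkeeping lemmas) and
ONE NAMED FACT `Thm415Pinned` (D-0014: a `def … : Prop`, never asserted; net Literature debt of this file: +1).  HC_CM is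
proved only modulo the 7 printed citations until rung 0 closes; this file discharges none of them.

## The printed text (Y. Liu, Camb. J. Math. 9 (2021) = arXiv:2102.11518, `FJcycle.tex` md5 6db49a74122d; print pp. 49–53)

§4.3, l. 2162–2174, VERBATIM: «Suppose that `n ≥ 3` and consider an adèlic oscillator triple `(μ,ε,χ)` in which `μ` is of weight
one and `ε` is `μ`-admissible. Then `Hom_{ℚ_ℓ^{ac}[𝔾(𝔸_F^∞)]}(ι_ℓ ∘ ω(μ,ε,χ), H¹_ét(A_∞ ⊗_{E,τ'} ℂ, ℚ_ℓ^{ac}))` is a representation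
of `Gal(ℂ/τ'(E))` over `ℚ_ℓ^{ac}`. By Proposition 4.13, such representation is an `ℓ`-adic character, denoted by
`ρ_{τ',ι_ℓ}(μ,ε,χ) : Gal(ℂ/τ'(E)) → (ℚ_ℓ^{ac})^×`. It induces, via the isomorphism `ι_ℓ`, an automorphic character
`ρ_{τ',ℓ}(μ,ε,χ) : τ'(E)^× \ 𝔸_{τ'(E)}^× → ℂ^×`. It is easy to see that the character `ρ_{τ',ℓ}(μ,ε,χ)` does not depend on the
isomorphism of `ι_ℓ`, which justifies its notation.»
**THEOREM 4.15** (l. 2177–2182, print p. 50 L24–27), VERBATIM: «Suppose that `n ≥ 3` and let `(μ,ε,χ)` be an adèlic oscillator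
triple in which `μ` is of weight one and `ε` is `μ`-admissible. Then we have `ρ_{τ',ℓ}(μ,ε,χ) ∘ τ' = μ^{alg}` for every
`τ' ∈ Φ_μ` and every rational prime `ℓ`.»
**Its use in the proof of Thm 4.18** (l. 2250, 2258–2268, print pp. 52–53), VERBATIM: «It is clear that the maximal subspace of
the complex vector space `H¹_{B,τ'}(A_μ, ℂ)` over which `M_μ` acts via the inclusion `M_μ ↪ ℂ` has dimension `1`. We choose a
basis `α` of this subspace. […] By Faltings' isogeny theorem [Fal83], we have a canonical isomorphism
`Ω(μ) ⊗_{M_μ,ι_ℓ} ℚ_ℓ^{ac} ≃ Hom_{ℚ_ℓ^{ac}[Gal(ℂ/τ'(E))]}(ℚ_ℓ^{ac}·α, H¹_ét(A_μ ⊗_{E,τ'} ℂ, ℚ_ℓ^{ac}))`. However, by Definition 4.5 (2),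
the action of `Gal(ℂ/τ'(E))` on the line `ℚ_ℓ^{ac}·α` spanned by `α` is given by the automorphic character
`ι_ℓ ∘ μ^{alg} ∘ (τ')⁻¹ : τ'(E)^× \ 𝔸_{τ'(E)}^× → (ℚ_ℓ^{ac})^×. When `n ≥ 3` […], by Proposition 4.13 […] and Theorem 4.15 […], we have
an isomorphism `Hom_{ℚ_ℓ^{ac}[Gal(ℂ/τ'(E))]}(ℚ_ℓ^{ac}·α, H¹_ét(A_μ ⊗_{E,τ'} ℂ, ℚ_ℓ^{ac})) ≃ ⊕_ε ⊕_χ ω(μ,ε,χ) ⊗_{ℂ,ι_ℓ} ℚ_ℓ^{ac}` of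
`ℚ_ℓ^{ac}[𝔾(𝔸_F^∞)]`-modules induced by pulling back `α`».  **Def. 4.5 (2)** second bullet (l. 1952): «the associated CM character of
`A_μ` with respect to the inclusion `M_μ ↪ ℂ` coincides with `μ^{alg}`» for a CM datum `D_μ = (A_μ, i_μ, λ_μ, r_μ)`,
`i_μ : M_μ → End_E(A_μ)_ℚ` a CM structure (l. 1944–1958).

## The typing («pinned»: over the REAL `ℓ`-adic tower of `EtaleH1Tower.lean`, not over bare carriers)

The tree already has Thm 4.15 over BARE carriers: `Literature.AlgebraicGeometry.Liu2021.LiuAlbaneseCMDatum.Thm415`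
(`AlgebraicGeometry/Liu2021/AlbaneseUnitaryShimuraCM.lean` :159) types «`ρ_{τ',ℓ}(μ,ε,χ) ∘ τ' = μ^{alg}`» as the equality of two
posited elements of one bare type `HeckeE` — not instantiable at the §4.2 tower.  Here the SAME printed content is stated at the
tower of `EtaleH1Tower.lean` in the form the proof of Thm 4.18 consumes it (l. 2258–2268): the Galois group acts on the Hom-space
`Hom_{ℚ_ℓ^{ac}[𝔾]}(ι_ℓ ∘ ω(μ,ε,χ), ℚ_ℓ^{ac} ⊗ H¹_ét(A_∞))` through the SAME `(ℚ_ℓ^{ac})^×`-valued character by which it acts on the line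
`ℚ_ℓ^{ac}·α`, the `M_μ`-eigenline of `ℚ_ℓ^{ac} ⊗_{ℚ_ℓ} H¹_ét(A_μ)` for the eigencharacter `ι_ℓ|_{M_μ}` («`M_μ` acts via the inclusion
`M_μ ↪ ℂ`», transported by `ι_ℓ`).  This is [Thm 4.15] ∧ [Def 4.5 (2) as used at l. 2263] with the automorphic character `μ^{alg}`
ELIMINATED between them (A-plan2 decision (3): «the identification "that eigenline character = μ^{alg}'s avatar" stays INSIDE the
cited Thm 4.15 / Def 4.5», so that the consumer's Faltings step `S_F` is linear algebra over ONE shared character object and no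
uniqueness-of-characters step — Chebotarev, Artin reciprocity for algebraic Hecke characters: absent — is needed).  Objects:
* `C : Sec42Data P5 isotropicAt` (§4.2 standing data, `n = C.n`, `𝔾(𝔸_F^∞) = C.G`), `U : UniformOmega C` (the ⟨CARRIER⟩ family
  `ω(μ,ε,χ)` with its `C.G`-action `U.rho μ hμ ε χ`, Def 4.11 — `Prop413DataOfTower.lean`), `X : C.EtaleHeckeDatum ℓ` (the Hecke
  action on the REAL tower `C.etaleH1Tower ℓ`, `EtaleH1Tower.lean`), `ι : ℂ ≃+* ℚ_ℓ^{ac}`;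
* `μ` conjugate symplectic (`hμ`, Def 4.1) of weight one (`HasWeight E μ 1`, Def 4.3 (1)), `ε : U.Eps` `μ`-admissible (Def 4.12, token
  for token `Thm418Data.IsAdmissible` / `Prop413Data.Triple.IsAdmissible`: `∃ e, IsAdmissibleElement E Φ_μ e ∧ U.epsOf e = ε`),
  `χ : U.Chi`; «Suppose that `n ≥ 3`» = the antecedent `3 ≤ C.n`;
* the CM abelian variety: `Aμ : AbelianVariety E` with `iμ : M_μ →+* End⁰(Aμ)`, `M_μ = IdeleClassGroup.muAlgValueField E μ ⊆ ℂ`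
  (Liu's `M_μ`, `IdeleClassCharacterAlgebraicTwist.lean`) — the REAL fields `A`, `i` of the tree's as-printed Def 4.5 datum
  `Def45.CMDatum` (`Def45AsPrinted.lean`), resp. `RestOne.AμOne ∕ iOne` at the END; `M_μ` acts on `V_ℓ(Aμ)` through the tree's
  PROVED `AbelianVariety.rationalTateAction` (Serre–Tate §4, `TateModuleOfCMFreeRankOne.lean`) and on `H¹ = V_ℓ^∨` by transpose;
* «`ι_ℓ ∘ ω(μ,ε,χ)`» and «`⊗_{ℂ,ι_ℓ} ℚ_ℓ^{ac}`»: along an ISOMORPHISM `ι_ℓ` extension of scalars is restriction of scalars, so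
  `Hom_{ℚ_ℓ^{ac}[𝔾]}(ι_ℓ ∘ ω, ℚ_ℓ^{ac} ⊗ H¹_ét(A_∞))` is typed as the `ℚ_ℓ^{ac}`-module of `ι`-SEMILINEAR `C.G`-equivariant maps
  `ω →ₛₗ[ι] ℚ_ℓ^{ac} ⊗_{ℚ_ℓ} H¹_ét(A_∞)` (`EtaleHeckeDatum.omegaHom`), on which `Γ_E` acts by post-composition with `towerRep σ` (it
  preserves the Hom-space because Hecke and Galois commute, `towerRep_comp_mem_omegaHom`);
* GALOIS GROUP `Γ_E = Gal(Ē/E) = Field.absoluteGaloisGroup E` instead of print's `Gal(ℂ/τ'(E))` (module docstring of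
  `EtaleH1Tower.lean`, A-plan2 decision (2)): restriction along an `E`-embedding `Ē ↪ ℂ` over `τ'` maps `Aut(ℂ/τ'E)` onto `Γ_E`
  and identifies `H¹_ét(A ⊗_{E,τ'} ℂ)` with `H¹_ét(A ⊗_E Ē)` for `A = A_K, A_μ` simultaneously; both the Hom-space character
  `ρ_{τ',ι_ℓ}` and the `α`-line character factor through `Γ_E`, and on `Γ_E` NEITHER depends on `τ'` (the composite
  `ρ_{τ',ℓ} ∘ τ'` of print is the `Γ_E`-character read through the Artin map of `E`).  Hence the printed quantifier «for every
  `τ' ∈ Φ_μ`» has no variable left to bind in this edition and is not displayed: the pinned sentence is print's Thm 4.15 for any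
  one `τ' ∈ Φ_μ` (`Φ_μ ≠ ∅`), i.e. exactly its content.  WEAKER-THAN-PRINT: nothing is said about `ρ_{τ',ℓ}` as an automorphic
  character (no Artin map is applied); EQUAL-TO-PRINT in what the proof of Thm 4.18 consumes (l. 2263–2268).
* SHAPE of the conclusion: «acts through the same character» = for every `σ ∈ Γ_E` and every scalar `c ∈ ℚ_ℓ^{ac}` that IS the
  eigenvalue of `σ` on some non-zero vector of the `α`-line, `σ ∘ f = c • f` for every `f` in the Hom-space.  (For a genuine CM datum
  the `α`-line is a LINE — `[M_μ:ℚ] = 2 dim A_μ`, Serre–Tate §4 Thm 5 (i), tree `exists_bijective_cmTateAction` — so `c` is THE value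
  of its Galois character at `σ`; at junk `(Aμ, iμ)` with zero eigenline the sentence is vacuous, never false.)  The dimension of the
  Hom-space («By Proposition 4.13, such representation is an `ℓ`-adic character», i.e. it is a line) is NOT restated here — it is
  the content of the binder `h413` / the consumer's `S_P`, and restating it would vendor a slice of Prop 4.13.
* ORIENTATION: no convention is chosen in this file — `μ` (not `μ^c`), `Φ_μ = hμ.cmType`, the admissible `ε`, `H¹ = V_ℓ^∨` and the
  eigencharacter «inclusion `M_μ ↪ ℂ`» are print's tokens; which incoherent space the consumer's `C` is (the S1/H-R3 question) is
  decided by the consumer's instantiation, see `A-plan/A3-ORIENTATION.md` §3 of the cell (REF1 PASS 2026-08-28T00:37:23Z).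

Nothing is asserted: a consumer takes `(h : Thm415Pinned C U ℓ X ι μ hμ Aμ iμ)` for ITS OWN data; `∀ …, Thm415Pinned …` is not
claimed.  NO PROOF (Track 2: Liu's proof uses [MR92] Prop 6, theta functions in the Fock model, App. D Thm D.6 (1)).

## References
* [Liu2021] §4.3 l. 2152–2174; Thm 4.15 l. 2177–2213; Def 4.5 (2) l. 1944–1958; Thm 4.18 proof l. 2247–2268; Def 4.11–4.12.
* [SerreTate1968] §4 (the `F_ℓ`-module `V_ℓ`); tree `AbelianVariety.rationalTateAction`, `cmTateAction`.
-/

noncomputable section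

open CategoryTheory NumberField
open scoped TensorProduct

namespace Literature.NumberTheory.Automorphic.Liu2021.AppendixC

open Literature.AlgebraicGeometry.Motives (AbelianVariety)
open Literature.AlgebraicGeometry.Liu2021 (IsAdmissibleElement)

/-! ## 1. The `M_μ`-eigenline `ℚ_ℓ^{ac}·α` of `ℚ_ℓ^{ac} ⊗_{ℚ_ℓ} H¹_ét(A_μ)` and the Galois action on it (any base field `E`) -/

section CMLine

variable {E : Type} [Field E] (ℓ : ℕ) [Fact ℓ.Prime]

/-- **The line `ℚ_ℓ^{ac}·α`** (Thm 4.18 proof, l. 2250 with l. 2258): for an abelian variety `B` over `E` with an action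
`i : M → End⁰(B)` of a subfield `M ⊆ ℂ` (Liu: `(A_μ, i_μ)`, `M = M_μ`) and `ι : ℂ ≃+* ℚ_ℓ^{ac}`, the `ℚ_ℓ^{ac}`-subspace of
`ℚ_ℓ^{ac} ⊗_{ℚ_ℓ} H¹_ét(B ⊗_E Ē, ℚ_ℓ)`, `H¹ = V_ℓ(B)^∨`, «over which `M` acts via the inclusion `M ↪ ℂ`» read through `ι_ℓ`: the common
eigenspace `{x | (1 ⊗ ᵗV_ℓ(i m)) x = ι(m) • x for all m ∈ M}` (`M` acts on `V_ℓ(B)` by the tree's `AbelianVariety.rationalTateAction`,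
on `H¹` by transpose).  For a CM structure (`[M:ℚ] = 2 dim B`) this is a line (Serre–Tate §4 Thm 5 (i)); not asserted here.
[cite: Liu2021, Thm 4.18 proof (FJcycle.tex l. 2250, 2258)] [cite: SerreTate1968, §4 Thm. 5 (i)] -/
def cmEigenline (B : AbelianVariety E) (M : Subfield ℂ) (i : M →+* B.endAlgebra) (ι : ℂ ≃+* AlgebraicClosure ℚ_[ℓ]) :
    Submodule (AlgebraicClosure ℚ_[ℓ]) (AlgebraicClosure ℚ_[ℓ] ⊗[ℚ_[ℓ]] Module.Dual ℚ_[ℓ] (B.rationalTateModule ℓ)) where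
  carrier := {x | ∀ m : M,
    ((AbelianVariety.rationalTateAction B ℓ (i m)).dualMap).baseChange (AlgebraicClosure ℚ_[ℓ]) x = ι (m : ℂ) • x}
  zero_mem' := fun m => by simp
  add_mem' := fun {x y} hx hy m => by rw [map_add, hx m, hy m, smul_add]
  smul_mem' := fun c x hx m => by rw [map_smul, hx m, smul_comm]

/-- Unfolding of the eigenline condition. [cite: Liu2021, Thm 4.18 proof (FJcycle.tex l. 2250)] -/
theorem mem_cmEigenline_iff (B : AbelianVariety E) (M : Subfield ℂ) (i : M →+* B.endAlgebra)
    (ι : ℂ ≃+* AlgebraicClosure ℚ_[ℓ]) (x : AlgebraicClosure ℚ_[ℓ] ⊗[ℚ_[ℓ]] Module.Dual ℚ_[ℓ] (B.rationalTateModule ℓ)) :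
    x ∈ cmEigenline ℓ B M i ι ↔ ∀ m : M,
      ((AbelianVariety.rationalTateAction B ℓ (i m)).dualMap).baseChange (AlgebraicClosure ℚ_[ℓ]) x = ι (m : ℂ) • x :=
  Iff.rfl

/-- **The Galois action on `ℚ_ℓ^{ac} ⊗_{ℚ_ℓ} H¹_ét(B ⊗_E Ē, ℚ_ℓ)`**: `σ ↦ 1 ⊗ ᵗρ_B(σ⁻¹)`, the contragredient of the tree's
`B.rationalTateRep ℓ` (Serre–Tate §1), base-changed to `ℚ_ℓ^{ac}` — the action of print's «`Gal(ℂ/τ'(E))` on the line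
`ℚ_ℓ^{ac}·α`» (l. 2263), read on `Γ_E`. [cite: Liu2021, Thm 4.18 proof (FJcycle.tex l. 2263)] [cite: SerreTate1968, §1] -/
def galoisH1Bar (B : AbelianVariety E) (σ : Field.absoluteGaloisGroup E) :
    AlgebraicClosure ℚ_[ℓ] ⊗[ℚ_[ℓ]] Module.Dual ℚ_[ℓ] (B.rationalTateModule ℓ) →ₗ[AlgebraicClosure ℚ_[ℓ]]
      AlgebraicClosure ℚ_[ℓ] ⊗[ℚ_[ℓ]] Module.Dual ℚ_[ℓ] (B.rationalTateModule ℓ) :=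
  (((B.rationalTateRep ℓ).dual) σ).baseChange (AlgebraicClosure ℚ_[ℓ])

/-- Unfolding on pure tensors: `galoisH1Bar σ (c ⊗ φ) = c ⊗ (φ ∘ ρ_B(σ⁻¹))`. [cite: Liu2021, Thm 4.18 proof (FJcycle.tex l. 2263)] -/
theorem galoisH1Bar_tmul (B : AbelianVariety E) (σ : Field.absoluteGaloisGroup E) (c : AlgebraicClosure ℚ_[ℓ])
    (φ : Module.Dual ℚ_[ℓ] (B.rationalTateModule ℓ)) :
    galoisH1Bar ℓ B σ (c ⊗ₜ φ) = c ⊗ₜ ((B.rationalTateRep ℓ).dual σ φ) :=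
  LinearMap.baseChange_tmul _ _ _

end CMLine

variable {F E : Type} [Field F] [NumberField F] [IsTotallyReal F] [Field E] [NumberField E] [Algebra F E]
  [IsTotallyComplex E] [Algebra.IsQuadraticExtension F E]
variable {P5 : PropC5Data F E} {isotropicAt : ℕ → Prop}

/-! ## 2. `Hom_{ℚ_ℓ^{ac}[𝔾(𝔸_F^∞)]}(ι_ℓ ∘ ω, ℚ_ℓ^{ac} ⊗ H¹_ét(A_∞))` and the Galois action on it -/

namespace Sec42Data.EtaleHeckeDatum

variable {C : Sec42Data P5 isotropicAt} {ℓ : ℕ} [Fact ℓ.Prime]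

/-- **`Hom_{ℚ_ℓ^{ac}[𝔾(𝔸_F^∞)]}(ι_ℓ ∘ ω, H¹_ét(A_∞ ⊗_{E,τ'} ℂ, ℚ_ℓ^{ac}))`** (§4.3, l. 2162–2165) for a `ℂ[𝔾(𝔸_F^∞)]`-module `(W, ρW)`
(«`ι_ℓ ∘ ω(μ,ε,χ)`»): the `ℚ_ℓ^{ac}`-submodule of `ι`-semilinear maps `W → ℚ_ℓ^{ac} ⊗_{ℚ_ℓ} H¹_ét(A_∞ ⊗_E Ē, ℚ_ℓ)` intertwining `ρW` with
the Hecke action `X.rhoEt` (extension of scalars along the isomorphism `ι_ℓ` = restriction of scalars, module docstring).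
[cite: Liu2021, §4.3 (FJcycle.tex l. 2162–2165)] -/
def omegaHom (X : C.EtaleHeckeDatum ℓ) (ι : ℂ ≃+* AlgebraicClosure ℚ_[ℓ]) {W : Type} [AddCommGroup W] [Module ℂ W]
    (ρW : Representation ℂ C.G W) :
    Submodule (AlgebraicClosure ℚ_[ℓ])
      (W →ₛₗ[(ι : ℂ →+* AlgebraicClosure ℚ_[ℓ])] AlgebraicClosure ℚ_[ℓ] ⊗[ℚ_[ℓ]] C.etaleH1Tower ℓ) where
  carrier := {f | ∀ (g : C.G) (w : W), f (ρW g w) = (X.rhoEt g).baseChange (AlgebraicClosure ℚ_[ℓ]) (f w)}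
  zero_mem' := fun g w => by simp
  add_mem' := fun {f f'} hf hf' g w => by
    simp only [LinearMap.add_apply, map_add, hf g w, hf' g w]
  smul_mem' := fun c f hf g w => by
    simp only [LinearMap.smul_apply, map_smul, hf g w]

/-- Unfolding of the Hom-space: `f ∈ omegaHom` iff `f ∘ ρW(g) = (1 ⊗ rhoEt g) ∘ f` for all `g`.
[cite: Liu2021, §4.3 (FJcycle.tex l. 2162–2165)] -/
theorem mem_omegaHom_iff (X : C.EtaleHeckeDatum ℓ) (ι : ℂ ≃+* AlgebraicClosure ℚ_[ℓ]) {W : Type} [AddCommGroup W] [Module ℂ W]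
    (ρW : Representation ℂ C.G W)
    (f : W →ₛₗ[(ι : ℂ →+* AlgebraicClosure ℚ_[ℓ])] AlgebraicClosure ℚ_[ℓ] ⊗[ℚ_[ℓ]] C.etaleH1Tower ℓ) :
    f ∈ X.omegaHom ι ρW ↔ ∀ (g : C.G) (w : W), f (ρW g w) = (X.rhoEt g).baseChange (AlgebraicClosure ℚ_[ℓ]) (f w) :=
  Iff.rfl

/-- «is a representation of `Gal(ℂ/τ'(E))` over `ℚ_ℓ^{ac}`» (l. 2166): post-composition with the Galois action `σ ⊗ 1` on
`ℚ_ℓ^{ac} ⊗ H¹_ét(A_∞)` preserves the Hom-space, because the Hecke action commutes with `Γ_E` (`EtaleHeckeDatum.comm`).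
[cite: Liu2021, §4.3 (FJcycle.tex l. 2160–2166)] -/
theorem towerRep_comp_mem_omegaHom (X : C.EtaleHeckeDatum ℓ) (ι : ℂ ≃+* AlgebraicClosure ℚ_[ℓ]) {W : Type} [AddCommGroup W]
    [Module ℂ W] (ρW : Representation ℂ C.G W)
    {f : W →ₛₗ[(ι : ℂ →+* AlgebraicClosure ℚ_[ℓ])] AlgebraicClosure ℚ_[ℓ] ⊗[ℚ_[ℓ]] C.etaleH1Tower ℓ}
    (hf : f ∈ X.omegaHom ι ρW) (σ : Field.absoluteGaloisGroup E) :
    ((C.towerRep ℓ σ).baseChange (AlgebraicClosure ℚ_[ℓ])).comp f ∈ X.omegaHom ι ρW := by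
  intro g w
  have hc : X.rhoEt g ∘ₗ C.towerRep ℓ σ = C.towerRep ℓ σ ∘ₗ X.rhoEt g := LinearMap.ext (X.comm g σ)
  have hbc := congrArg (LinearMap.baseChange (AlgebraicClosure ℚ_[ℓ])) hc
  rw [LinearMap.baseChange_comp, LinearMap.baseChange_comp] at hbc
  simp only [LinearMap.coe_comp, Function.comp_apply, hf g w]
  exact (LinearMap.congr_fun hbc (f w)).symm

end Sec42Data.EtaleHeckeDatum

/-! ## 3. Theorem 4.15, pinned -/

/-- **[Liu2021, Theorem 4.15] PINNED at the `ℓ`-adic cohomology of the Albanese tower** — print (l. 2177–2182): «Suppose that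
`n ≥ 3` and let `(μ,ε,χ)` be an adèlic oscillator triple in which `μ` is of weight one and `ε` is `μ`-admissible. Then we have
`ρ_{τ',ℓ}(μ,ε,χ) ∘ τ' = μ^{alg}` for every `τ' ∈ Φ_μ` and every rational prime `ℓ`», where `ρ_{τ',ι_ℓ}(μ,ε,χ)` is the character by
which `Gal(ℂ/τ'(E))` acts on `Hom_{ℚ_ℓ^{ac}[𝔾(𝔸_F^∞)]}(ι_ℓ ∘ ω(μ,ε,χ), H¹_ét(A_∞ ⊗_{E,τ'} ℂ, ℚ_ℓ^{ac}))` (§4.3, l. 2162–2174), COMBINED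
WITH Def 4.5 (2) as the proof of Thm 4.18 uses it (l. 2263): «the action of `Gal(ℂ/τ'(E))` on the line `ℚ_ℓ^{ac}·α` is given by
`ι_ℓ ∘ μ^{alg} ∘ (τ')⁻¹`», `α` spanning the subspace of `H¹(A_μ)` «over which `M_μ` acts via the inclusion `M_μ ↪ ℂ`» (l. 2250) —
`μ^{alg}` eliminated between the two (module docstring, «The typing»).

TYPED, for the §4.2 datum `C`, the oscillator carriers `U` (Def 4.11), a Hecke datum `X` on `H¹_ét(A_∞ ⊗_E Ē, ℚ_ℓ)`
(`EtaleH1Tower.lean`), `ι : ℂ ≃+* ℚ_ℓ^{ac}`, a conjugate symplectic `μ` (`hμ`), and the CM pair `(Aμ, iμ : M_μ → End⁰(Aμ))` of a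
Def 4.5 datum: IF `3 ≤ n` and `μ` has weight one, THEN for every `μ`-admissible `ε` (Def 4.12 over `U.epsOf` and
`Φ_μ = hμ.cmType`), every `χ`, every `σ ∈ Γ_E = Gal(Ē/E)` and every `c ∈ ℚ_ℓ^{ac}` such that `σ` acts by `c` on some non-zero vector of
the eigenline `cmEigenline ℓ Aμ M_μ iμ ι` («`ℚ_ℓ^{ac}·α`»), `σ` acts by `c` on the whole Hom-space:
`(σ ⊗ 1) (f w) = c • f w` for every `f ∈ X.omegaHom ι (U.rho μ hμ ε χ)` and every `w`.  Galois group `Γ_E` instead of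
`Gal(ℂ/τ'(E))` and no displayed `τ' ∈ Φ_μ` (both characters are `τ'`-free on `Γ_E`; module docstring, GALOIS GROUP); no Artin
map applied (WEAKER-THAN-PRINT there); the dimension of the Hom-space is left to Prop 4.13 (binder `h413`), not restated.
Bare-carrier edition of the same sentence: `Literature.AlgebraicGeometry.Liu2021.LiuAlbaneseCMDatum.Thm415`.  A consumer takes
`(h : Thm415Pinned C U ℓ X ι μ hμ Aμ iμ)` for ITS OWN data (orientation = the consumer's instantiation of `C`, A3-ORIENTATION §3 of
the cell `hodgecm-mathlib`); `∀ …, Thm415Pinned …` is not the theorem and is not claimed.  NO PROOF.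
[cite: Liu2021, Thm. 4.15 (FJcycle.tex l. 2177–2182) with §4.3 (l. 2162–2174), Def. 4.5 (2) (l. 1952) and Thm. 4.18 proof (l. 2250–2268)] -/
def Thm415Pinned (C : Sec42Data P5 isotropicAt) (U : UniformOmega C) (ℓ : ℕ) [Fact ℓ.Prime] (X : C.EtaleHeckeDatum ℓ)
    (ι : ℂ ≃+* AlgebraicClosure ℚ_[ℓ]) (μ : IdeleClassGroup E →ₜ* Circle)
    (hμ : letI : IsCMField E := isCMField F E; IdeleClassGroup.IsConjugateSymplectic E μ)
    (Aμ : AbelianVariety E) (iμ : IdeleClassGroup.muAlgValueField E μ →+* Aμ.endAlgebra) : Prop :=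
  letI : IsCMField E := isCMField F E
  -- «Suppose that n ≥ 3 … μ is of weight one» (l. 2177–2178)
  3 ≤ C.n → IdeleClassGroup.HasWeight E μ 1 →
    -- «and ε is μ-admissible» (Def. 4.12), every χ
    ∀ (ε : U.Eps), (∃ e : E, IsAdmissibleElement E hμ.cmType.1 e ∧ U.epsOf e = ε) → ∀ (χ : U.Chi)
      -- the Galois element and its eigenvalue on the line ℚ_ℓ^{ac}·α of H¹(A_μ) (l. 2250, 2263)
      (σ : Field.absoluteGaloisGroup E) (c : AlgebraicClosure ℚ_[ℓ]),
      (∃ x ∈ cmEigenline ℓ Aμ (IdeleClassGroup.muAlgValueField E μ) iμ ι, x ≠ 0 ∧ galoisH1Bar ℓ Aμ σ x = c • x) →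
        -- … is the value at σ of ρ_{τ',ι_ℓ}(μ,ε,χ): σ acts by c on Hom_{ℚ_ℓ^{ac}[𝔾]}(ι_ℓ ∘ ω(μ,ε,χ), ℚ_ℓ^{ac} ⊗ H¹_ét(A_∞)) (l. 2166–2168, 2177–2182)
        ∀ f ∈ X.omegaHom ι (U.rho μ hμ ε χ), ∀ w : U.omega μ hμ ε χ,
          (C.towerRep ℓ σ).baseChange (AlgebraicClosure ℚ_[ℓ]) (f w) = c • f w

/-- Dot-free restatement of the conclusion of `Thm415Pinned` for one `(ε, χ, σ, c)`: unfolding only (`Iff.rfl`-level bookkeeping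
for consumers). [cite: Liu2021, Thm. 4.15 (FJcycle.tex l. 2177–2182)] -/
theorem Thm415Pinned.apply {C : Sec42Data P5 isotropicAt} {U : UniformOmega C} {ℓ : ℕ} [Fact ℓ.Prime]
    {X : C.EtaleHeckeDatum ℓ} {ι : ℂ ≃+* AlgebraicClosure ℚ_[ℓ]} {μ : IdeleClassGroup E →ₜ* Circle}
    {hμ : letI : IsCMField E := isCMField F E; IdeleClassGroup.IsConjugateSymplectic E μ}
    {Aμ : AbelianVariety E} {iμ : IdeleClassGroup.muAlgValueField E μ →+* Aμ.endAlgebra}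
    (h : Thm415Pinned C U ℓ X ι μ hμ Aμ iμ) (hn : 3 ≤ C.n)
    (hw : letI : IsCMField E := isCMField F E; IdeleClassGroup.HasWeight E μ 1)
    (ε : U.Eps) (hε : letI : IsCMField E := isCMField F E; ∃ e : E, IsAdmissibleElement E hμ.cmType.1 e ∧ U.epsOf e = ε)
    (χ : U.Chi) (σ : Field.absoluteGaloisGroup E) (c : AlgebraicClosure ℚ_[ℓ])
    (hc : ∃ x ∈ cmEigenline ℓ Aμ (IdeleClassGroup.muAlgValueField E μ) iμ ι, x ≠ 0 ∧ galoisH1Bar ℓ Aμ σ x = c • x)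
    {f : U.omega μ hμ ε χ →ₛₗ[(ι : ℂ →+* AlgebraicClosure ℚ_[ℓ])] AlgebraicClosure ℚ_[ℓ] ⊗[ℚ_[ℓ]] C.etaleH1Tower ℓ}
    (hf : f ∈ X.omegaHom ι (U.rho μ hμ ε χ)) (w : U.omega μ hμ ε χ) :
    (C.towerRep ℓ σ).baseChange (AlgebraicClosure ℚ_[ℓ]) (f w) = c • f w :=
  h hn hw ε hε χ σ c hc f hf w

end Literature.NumberTheory.Automorphic.Liu2021.AppendixC
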